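import Summits.NavierStokesRegularity.NavierStokesRegularity.Theorems.EfficiencyFloorNearSaturationNearMaximiserSeqCoreLocalL4
import HarnessLib

/-!
# Route `EfficiencyFloor`, crux `NearSaturationNearMaximiser` (stmt-NavierStokesRegularity-25482) on the
# `ProductionEfficiencyDecay` ladder (stmt-22866): the QUADRATIC mixed stretching terms (census item (c'-quad))

Def-free helper file, ninth of the group (`…SeqCoreWeakPairing`, `…SeqCoreWeak`, `…SeqCoreWeakCurl`, `…SeqCoreLocalL4`). The clause
(c'-quad) of (P_w''') — along admissible `u_k` with bounded `Z, Pal` and an admissible `w`, the three mixed trilinear stretching terms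
QUADRATIC in `r_k = u_k − w`, `T(r_k,r_k,w) + T(r_k,w,r_k) + T(w,r_k,r_k)`, tend to zero — is PROVED here from the local strong
convergence `∫_{B(0,R)} ‖curl r_k‖² → 0` on EVERY ball: split `ℝ³ = B(0,R) ∪ B(0,R)ᶜ`; on the ball, Cauchy–Schwarz twice and the local
`L⁴` smallness `∫_{B(0,R)}‖curl r_k‖⁴ → 0` (`tendsto_setIntegral_curl_pow_four`); off the ball, the uniform `L⁴`/`L²` bounds on
`curl r_k`, `Dr_k` against the TAILS `∫_{B(0,R)ᶜ}‖curl w‖⁴ → 0`, `∫_{B(0,R)ᶜ}‖Dw‖² → 0` (`tendsto_setIntegral_of_antitone`).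

* `setIntegral_mul_le_sqrt`, `setIntegral_sq_mul_sq_le`, `setIntegral_norm_mul_norm_mul_norm_le` — Hölder on a set;
* `tendsto_setIntegral_compl_ball` — tails of an integrable function; `tendsto_zero_of_le_add` — the `ε/2` bookkeeping;
* `tendsto_quadratic_mixed_of_localL2` — (c'-quad). The by-name reduction of stmt-25482 to (a') local `L²` convergence on every ball +
  (b''') weak convergence of the gradients is stated in the next file of the group (`…SeqCoreLocalProfile`).

HONEST FRAMING: local Rellich on balls and the identification of the weak limit with an ADMISSIBLE profile (regularity and decay of
Lu–Doering extremisers) are NOT proved; stmt-25482, `LerayFloorGap`, `ProductionEfficiencyDecay` (stmt-22866) and Navier–Stokes regularity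
stay OPEN; no summit statement is proved. [folklore]
-/

-- the problem directory repeats the summit name (`NavierStokesRegularity/NavierStokesRegularity`)
set_option linter.dupNamespace false

noncomputable section

namespace Summit.NavierStokesRegularity.NavierStokesRegularity.Theorems

namespace NearSaturationNearMaximiser

namespace SeqCore

open Set MeasureTheory Filter Topology Function
open scoped InnerProductSpace ENNReal NNReal
open Literature.Analysis.FluidPDE
open Magsanop2026Enstrophy (slice_integrable)

/-! ## §1 Hölder on a set -/

/-- `∫_s a·b ≤ √(∫_s a²)·√(∫_s b²)` for continuous `a, b ≥ 0` with `a², b² ∈ L¹`, on any set `s`. [folklore] -/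
theorem setIntegral_mul_le_sqrt {a b : EuclideanSpace ℝ (Fin 3) → ℝ} (ha : Continuous a) (hb : Continuous b)
    (ha0 : ∀ x, 0 ≤ a x) (hb0 : ∀ x, 0 ≤ b x) (ha2 : Integrable (fun x => a x ^ 2)) (hb2 : Integrable (fun x => b x ^ 2))
    (s : Set (EuclideanSpace ℝ (Fin 3))) :
    ∫ x in s, a x * b x ≤ Real.sqrt (∫ x in s, a x ^ 2) * Real.sqrt (∫ x in s, b x ^ 2) := by
  have ma : MemLp a 2 (volume.restrict s) :=
    ((memLp_two_iff_integrable_sq_norm ha.aestronglyMeasurable).2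
      (ha2.congr (ae_of_all _ fun x => by simp only [Real.norm_eq_abs, sq_abs]))).restrict s
  have mb : MemLp b 2 (volume.restrict s) :=
    ((memLp_two_iff_integrable_sq_norm hb.aestronglyMeasurable).2
      (hb2.congr (ae_of_all _ fun x => by simp only [Real.norm_eq_abs, sq_abs]))).restrict s
  have hH := integral_mul_le_Lp_mul_Lq_of_nonneg (μ := volume.restrict s)
    Real.HolderConjugate.two_two (f := a) (g := b) (ae_of_all _ ha0) (ae_of_all _ hb0)
    (by rw [ENNReal.ofReal_ofNat]; exact ma) (by rw [ENNReal.ofReal_ofNat]; exact mb)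
  have e1 : ∫ x in s, a x ^ (2 : ℝ) = ∫ x in s, a x ^ 2 := integral_congr_ae (ae_of_all _ fun x => by simp only [Real.rpow_two])
  have e2 : ∫ x in s, b x ^ (2 : ℝ) = ∫ x in s, b x ^ 2 := integral_congr_ae (ae_of_all _ fun x => by simp only [Real.rpow_two])
  rw [e1, e2] at hH
  have e4 : ∀ y : ℝ, y ^ (1 / (2 : ℝ)) = Real.sqrt y := fun y => by rw [Real.sqrt_eq_rpow]
  simp only [e4] at hH
  exact hH

/-- `∫_s a²b² ≤ √(∫_s a⁴)·√(∫_s b⁴)` (and `a²b² ∈ L¹`) for continuous `a, b` with `a⁴, b⁴ ∈ L¹`. [folklore] -/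
theorem setIntegral_sq_mul_sq_le {a b : EuclideanSpace ℝ (Fin 3) → ℝ} (ha : Continuous a) (hb : Continuous b)
    (ha4 : Integrable (fun x => a x ^ 4)) (hb4 : Integrable (fun x => b x ^ 4)) (s : Set (EuclideanSpace ℝ (Fin 3))) :
    Integrable (fun x => (a x * b x) ^ 2) ∧
      ∫ x in s, (a x * b x) ^ 2 ≤ Real.sqrt (∫ x in s, a x ^ 4) * Real.sqrt (∫ x in s, b x ^ 4) := by
  obtain ⟨hI, -⟩ := integral_sq_mul_sq_le ha hb ha4 hb4
  refine ⟨hI, ?_⟩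
  have ha4' : Integrable (fun x => (a x ^ 2) ^ 2) := ha4.congr (ae_of_all _ fun x => by simp only; ring)
  have hb4' : Integrable (fun x => (b x ^ 2) ^ 2) := hb4.congr (ae_of_all _ fun x => by simp only; ring)
  have h := setIntegral_mul_le_sqrt (a := fun x => a x ^ 2) (b := fun x => b x ^ 2) (ha.pow 2) (hb.pow 2)
    (fun x => sq_nonneg _) (fun x => sq_nonneg _) ha4' hb4' s
  have e1 : ∫ x in s, (a x ^ 2) ^ 2 = ∫ x in s, a x ^ 4 := integral_congr_ae (ae_of_all _ fun x => by simp only; ring)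
  have e2 : ∫ x in s, (b x ^ 2) ^ 2 = ∫ x in s, b x ^ 4 := integral_congr_ae (ae_of_all _ fun x => by simp only; ring)
  have e3 : ∫ x in s, a x ^ 2 * b x ^ 2 = ∫ x in s, (a x * b x) ^ 2 := integral_congr_ae (ae_of_all _ fun x => by simp only; ring)
  rw [e1, e2, e3] at h
  exact h

/-- **Trilinear Hölder bound on a set**: for continuous `f, g : ℝ³ → ℝ³` with `‖f‖⁴, ‖g‖⁴ ∈ L¹` and a continuous operator field `A`
with `‖A‖² ∈ L¹`: `‖f‖·‖g‖·‖A‖ ∈ L¹` and `∫_s ‖f‖‖g‖‖A‖ ≤ √(√(∫_s‖f‖⁴)·√(∫_s‖g‖⁴))·√(∫_s‖A‖²)`. [folklore] -/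
theorem setIntegral_norm_mul_norm_mul_norm_le {f g : EuclideanSpace ℝ (Fin 3) → EuclideanSpace ℝ (Fin 3)}
    {A : EuclideanSpace ℝ (Fin 3) → (EuclideanSpace ℝ (Fin 3) →L[ℝ] EuclideanSpace ℝ (Fin 3))}
    (hf : Continuous f) (hg : Continuous g) (hA : Continuous A)
    (hf4 : Integrable (fun x => ‖f x‖ ^ 4)) (hg4 : Integrable (fun x => ‖g x‖ ^ 4))
    (hA2 : Integrable (fun x => ‖A x‖ ^ 2)) (s : Set (EuclideanSpace ℝ (Fin 3))) :
    Integrable (fun x => ‖f x‖ * ‖g x‖ * ‖A x‖) ∧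
      ∫ x in s, ‖f x‖ * ‖g x‖ * ‖A x‖ ≤
        Real.sqrt (Real.sqrt (∫ x in s, ‖f x‖ ^ 4) * Real.sqrt (∫ x in s, ‖g x‖ ^ 4)) * Real.sqrt (∫ x in s, ‖A x‖ ^ 2) := by
  refine ⟨(integral_norm_mul_norm_mul_norm_le hf hg hA hf4 hg4 hA2).1, ?_⟩
  obtain ⟨hI2, hle2⟩ := setIntegral_sq_mul_sq_le hf.norm hg.norm hf4 hg4 s
  have h := setIntegral_mul_le_sqrt (a := fun x => ‖f x‖ * ‖g x‖) (b := fun x => ‖A x‖) (hf.norm.mul hg.norm) hA.norm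
    (fun x => mul_nonneg (norm_nonneg _) (norm_nonneg _)) (fun x => norm_nonneg _) hI2 hA2 s
  exact h.trans (mul_le_mul_of_nonneg_right (Real.sqrt_le_sqrt hle2) (Real.sqrt_nonneg _))

/-! ## §2 Tails and the `ε/2` bookkeeping -/

/-- **Tails of an integrable function**: `∫_{B(0,n)ᶜ} F → 0` as `n → ∞`. [folklore] -/
theorem tendsto_setIntegral_compl_ball {F : EuclideanSpace ℝ (Fin 3) → ℝ} (hF : Integrable F) :
    Tendsto (fun n : ℕ => ∫ x in (Metric.ball (0 : EuclideanSpace ℝ (Fin 3)) n)ᶜ, F x) atTop (𝓝 0) := by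
  have h := tendsto_setIntegral_of_antitone (μ := (volume : Measure (EuclideanSpace ℝ (Fin 3)))) (f := F)
    (s := fun n : ℕ => (Metric.ball (0 : EuclideanSpace ℝ (Fin 3)) n)ᶜ) (fun n => measurableSet_ball.compl)
    (fun m n hmn => compl_subset_compl.2 (Metric.ball_subset_ball (by exact_mod_cast hmn))) ⟨0, hF.integrableOn⟩
  have he : (⋂ n : ℕ, (Metric.ball (0 : EuclideanSpace ℝ (Fin 3)) (n : ℝ))ᶜ) = ∅ := by
    rw [← Set.compl_iUnion, Metric.iUnion_ball_nat, Set.compl_univ]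
  rw [he, setIntegral_empty] at h
  exact h

/-- **The `ε/2` bookkeeping.** If `|Q_k| ≤ A_R(k) + T_R` for all `R, k`, with `A_R(k) → 0` as `k → ∞` for each `R` and `T_R → 0`,
then `Q_k → 0`. [folklore] -/
theorem tendsto_zero_of_le_add {Q : ℕ → ℝ} {A : ℕ → ℕ → ℝ} {T : ℕ → ℝ} (hle : ∀ R k, |Q k| ≤ A R k + T R)
    (hA : ∀ R, Tendsto (A R) atTop (𝓝 0)) (hT : Tendsto T atTop (𝓝 0)) : Tendsto Q atTop (𝓝 0) := by
  rw [Metric.tendsto_atTop]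
  intro ε hε
  obtain ⟨R, hR⟩ := (Metric.tendsto_atTop.1 hT) (ε / 2) (half_pos hε)
  obtain ⟨N, hN⟩ := (Metric.tendsto_atTop.1 (hA R)) (ε / 2) (half_pos hε)
  refine ⟨N, fun k hk => ?_⟩
  have h1 := hR R le_rfl
  have h2 := hN k hk
  rw [Real.dist_0_eq_abs] at h1 h2 ⊢
  calc |Q k| ≤ A R k + T R := hle R k
    _ ≤ |A R k| + |T R| := add_le_add (le_abs_self _) (le_abs_self _)
    _ < ε / 2 + ε / 2 := add_lt_add h2 h1
    _ = ε := add_halves ε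

/-! ## §3 The quadratic mixed terms -/

/-- **The quadratic mixed terms vanish in the limit** (census item (c'-quad)). Along admissible `u_k` with `Z(u_k) ≤ M_Z`,
`Pal(u_k) ≤ M_P` and an admissible `w`, if `∫_{B(0,R)} ‖curl (u_k − w)‖² → 0` for every `R > 0`, then
`T(r_k,r_k,w) + T(r_k,w,r_k) + T(w,r_k,r_k) → 0` (`r_k = u_k − w`, `T(a,b,c) = ∫⟪curl a, Db (curl c)⟫`): ball/tail splitting,
Hölder on each piece, local `L⁴` smallness on the ball, tails of `‖curl w‖⁴, ‖Dw‖² ∈ L¹` off the ball. [folklore] -/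
theorem tendsto_quadratic_mixed_of_localL2 {u : ℕ → EuclideanSpace ℝ (Fin 3) → EuclideanSpace ℝ (Fin 3)}
    {w : EuclideanSpace ℝ (Fin 3) → EuclideanSpace ℝ (Fin 3)} {MZ MP : ℝ}
    (hu : ∀ k, ContDiff ℝ (⊤ : ℕ∞) (u k) ∧ VectorCalculus.IsDivFree (u k) ∧ (∫⁻ x, ‖iteratedFDeriv ℝ 0 (u k) x‖ₑ ^ 2 < ⊤) ∧
      (∫⁻ x, ‖iteratedFDeriv ℝ 1 (u k) x‖ₑ ^ 2 < ⊤) ∧ (∫⁻ x, ‖iteratedFDeriv ℝ 2 (u k) x‖ₑ ^ 2 < ⊤))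
    (hw : ContDiff ℝ (⊤ : ℕ∞) w ∧ VectorCalculus.IsDivFree w ∧ (∫⁻ x, ‖iteratedFDeriv ℝ 0 w x‖ₑ ^ 2 < ⊤) ∧
      (∫⁻ x, ‖iteratedFDeriv ℝ 1 w x‖ₑ ^ 2 < ⊤) ∧ (∫⁻ x, ‖iteratedFDeriv ℝ 2 w x‖ₑ ^ 2 < ⊤))
    (hZ : ∀ k, ∫ x, ‖curl (u k) x‖ ^ 2 ≤ MZ) (hP : ∀ k, ∫ x, frobeniusNormSq (fderiv ℝ (curl (u k)) x) ≤ MP)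
    (hloc : ∀ R : ℝ, 0 < R →
      Tendsto (fun k => ∫ x in Metric.ball (0 : EuclideanSpace ℝ (Fin 3)) R, ‖curl (u k - w) x‖ ^ 2) atTop (𝓝 0)) :
    Tendsto (fun k => (∫ x, ⟪curl (u k - w) x, fderiv ℝ (u k - w) x (curl w x)⟫_ℝ) +
      (∫ x, ⟪curl (u k - w) x, fderiv ℝ w x (curl (u k - w) x)⟫_ℝ) +
      (∫ x, ⟪curl w x, fderiv ℝ (u k - w) x (curl (u k - w) x)⟫_ℝ)) atTop (𝓝 0) := by
  have hr := fun k => admissible_sub (hu k) hw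
  -- data of `w`
  obtain ⟨I4w, IDw, -⟩ := stretch_integrable hw.1 hw.2.2.2.1 hw.2.2.2.2
  have hθc : Continuous (curl w) := (contDiff_curl (n := 1) (hw.1.of_le (by norm_cast))).continuous
  have hDwc : Continuous (fderiv ℝ w) := (hw.1.of_le (by norm_cast) : ContDiff ℝ 1 w).continuous_fderiv one_ne_zero
  -- uniform constants along `r_k = u_k − w`
  set CZ : ℝ := 2 * MZ + 2 * ∫ x, ‖curl w x‖ ^ 2 with hCZ
  set CP : ℝ := 2 * MP + 2 * ∫ x, frobeniusNormSq (fderiv ℝ (curl w) x) with hCP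
  have hZr : ∀ k, ∫ x, ‖curl (u k - w) x‖ ^ 2 ≤ CZ := fun k =>
    (enstrophy_sub_le (hu k).1 hw.1 (hu k).2.2.2.1 hw.2.2.2.1).trans (by linarith [hZ k])
  have hPr : ∀ k, ∫ x, frobeniusNormSq (fderiv ℝ (curl (u k - w)) x) ≤ CP := fun k =>
    (palinstrophy_sub_le (hu k).1 hw.1 (hu k).2.2.2.2 hw.2.2.2.2).trans (by linarith [hP k])
  have hCZ0 : 0 ≤ CZ := (integral_nonneg fun x => by positivity).trans (hZr 0)
  have hCP0 : 0 ≤ CP := (integral_nonneg fun x => frobeniusNormSq_nonneg _).trans (hPr 0)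
  set K : ℝ := (SNormLESNormFDerivOfEqConst (EuclideanSpace ℝ (Fin 3)) (volume : Measure (EuclideanSpace ℝ (Fin 3))) 2 : ℝ)
    with hK
  have hK0 : 0 ≤ K := NNReal.coe_nonneg _
  set C4 : ℝ := K ^ 3 * Real.sqrt CZ * (CP * Real.sqrt CP) with hC4
  have h4r : ∀ k, ∫ x, ‖curl (u k - w) x‖ ^ 4 ≤ C4 := by
    intro k
    refine (integral_curl_pow_four_le' (hr k).1 (hr k).2.2.2.1 (hr k).2.2.2.2).trans ?_
    have hP0 : 0 ≤ ∫ x, frobeniusNormSq (fderiv ℝ (curl (u k - w)) x) := integral_nonneg fun x => frobeniusNormSq_nonneg _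
    rw [hC4]
    gcongr
    · exact hZr k
    · exact hPr k
    · exact hPr k
  have hDr : ∀ k, ∫ x, ‖fderiv ℝ (u k - w) x‖ ^ 2 ≤ CZ := fun k => (integral_norm_fderiv_sq_le_enstrophy (hr k)).trans (hZr k)
  have hC40 : 0 ≤ C4 := (integral_nonneg fun x => by positivity).trans (h4r 0)
  set I4θ : ℝ := ∫ x, ‖curl w x‖ ^ 4 with hI4θ
  set ID : ℝ := ∫ x, ‖fderiv ℝ w x‖ ^ 2 with hID
  -- the bound `|Q_k| ≤ A_R(k) + T_R`, ball of radius `R + 1`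
  have hle : ∀ R k : ℕ, |(∫ x, ⟪curl (u k - w) x, fderiv ℝ (u k - w) x (curl w x)⟫_ℝ) +
      (∫ x, ⟪curl (u k - w) x, fderiv ℝ w x (curl (u k - w) x)⟫_ℝ) +
      (∫ x, ⟪curl w x, fderiv ℝ (u k - w) x (curl (u k - w) x)⟫_ℝ)| ≤
      (2 * (Real.sqrt (Real.sqrt (∫ x in Metric.ball (0 : EuclideanSpace ℝ (Fin 3)) ((R + 1 : ℕ) : ℝ), ‖curl (u k - w) x‖ ^ 4) *
          Real.sqrt I4θ) * Real.sqrt CZ) +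
        Real.sqrt (Real.sqrt (∫ x in Metric.ball (0 : EuclideanSpace ℝ (Fin 3)) ((R + 1 : ℕ) : ℝ), ‖curl (u k - w) x‖ ^ 4) *
          Real.sqrt (∫ x in Metric.ball (0 : EuclideanSpace ℝ (Fin 3)) ((R + 1 : ℕ) : ℝ), ‖curl (u k - w) x‖ ^ 4)) * Real.sqrt ID) +
      (2 * (Real.sqrt (Real.sqrt C4 * Real.sqrt (∫ x in (Metric.ball (0 : EuclideanSpace ℝ (Fin 3)) ((R + 1 : ℕ) : ℝ))ᶜ,
          ‖curl w x‖ ^ 4)) * Real.sqrt CZ) +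
        Real.sqrt (Real.sqrt C4 * Real.sqrt C4) *
          Real.sqrt (∫ x in (Metric.ball (0 : EuclideanSpace ℝ (Fin 3)) ((R + 1 : ℕ) : ℝ))ᶜ, ‖fderiv ℝ w x‖ ^ 2)) := by
    intro R k
    obtain ⟨I4r, IDr, -⟩ := stretch_integrable (hr k).1 (hr k).2.2.2.1 (hr k).2.2.2.2
    have hρc : Continuous (curl (u k - w)) := (contDiff_curl (n := 1) ((hr k).1.of_le (by norm_cast))).continuous
    have hDrc : Continuous (fderiv ℝ (u k - w)) :=
      ((hr k).1.of_le (by norm_cast) : ContDiff ℝ 1 (u k - w)).continuous_fderiv one_ne_zero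
    set s : Set (EuclideanSpace ℝ (Fin 3)) := Metric.ball (0 : EuclideanSpace ℝ (Fin 3)) ((R + 1 : ℕ) : ℝ) with hs
    have hsm : MeasurableSet s := measurableSet_ball
    -- the two integrable majorants `J1 = ‖ρ‖‖θ‖‖Dr‖`, `J2 = ‖ρ‖‖ρ‖‖Dw‖`, on the ball and off the ball
    obtain ⟨IJ1, B1s⟩ := setIntegral_norm_mul_norm_mul_norm_le hρc hθc hDrc I4r I4w IDr s
    obtain ⟨-, B1c⟩ := setIntegral_norm_mul_norm_mul_norm_le hρc hθc hDrc I4r I4w IDr sᶜ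
    obtain ⟨IJ2, B2s⟩ := setIntegral_norm_mul_norm_mul_norm_le hρc hρc hDwc I4r I4r IDw s
    obtain ⟨-, B2c⟩ := setIntegral_norm_mul_norm_mul_norm_le hρc hρc hDwc I4r I4r IDw sᶜ
    -- `|Q1|, |Q3| ≤ ∫ J1`, `|Q2| ≤ ∫ J2`
    have hQ1 : |∫ x, ⟪curl (u k - w) x, fderiv ℝ (u k - w) x (curl w x)⟫_ℝ| ≤
        ∫ x, ‖curl (u k - w) x‖ * ‖curl w x‖ * ‖fderiv ℝ (u k - w) x‖ :=
      abs_integral_le_integral_abs.trans (integral_mono_of_nonneg (ae_of_all _ fun x => abs_nonneg _) IJ1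
        (ae_of_all _ fun x => abs_inner_apply_le _ _ _))
    have hQ3 : |∫ x, ⟪curl w x, fderiv ℝ (u k - w) x (curl (u k - w) x)⟫_ℝ| ≤
        ∫ x, ‖curl (u k - w) x‖ * ‖curl w x‖ * ‖fderiv ℝ (u k - w) x‖ :=
      abs_integral_le_integral_abs.trans (integral_mono_of_nonneg (ae_of_all _ fun x => abs_nonneg _) IJ1
        (ae_of_all _ fun x => (abs_inner_apply_le _ _ _).trans (le_of_eq (by ring))))
    have hQ2 : |∫ x, ⟪curl (u k - w) x, fderiv ℝ w x (curl (u k - w) x)⟫_ℝ| ≤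
        ∫ x, ‖curl (u k - w) x‖ * ‖curl (u k - w) x‖ * ‖fderiv ℝ w x‖ :=
      abs_integral_le_integral_abs.trans (integral_mono_of_nonneg (ae_of_all _ fun x => abs_nonneg _) IJ2
        (ae_of_all _ fun x => abs_inner_apply_le _ _ _))
    -- split ball / tail
    have hJ1 : (∫ x, ‖curl (u k - w) x‖ * ‖curl w x‖ * ‖fderiv ℝ (u k - w) x‖) =
        (∫ x in s, ‖curl (u k - w) x‖ * ‖curl w x‖ * ‖fderiv ℝ (u k - w) x‖) +
        ∫ x in sᶜ, ‖curl (u k - w) x‖ * ‖curl w x‖ * ‖fderiv ℝ (u k - w) x‖ := (integral_add_compl hsm IJ1).symm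
    have hJ2 : (∫ x, ‖curl (u k - w) x‖ * ‖curl (u k - w) x‖ * ‖fderiv ℝ w x‖) =
        (∫ x in s, ‖curl (u k - w) x‖ * ‖curl (u k - w) x‖ * ‖fderiv ℝ w x‖) +
        ∫ x in sᶜ, ‖curl (u k - w) x‖ * ‖curl (u k - w) x‖ * ‖fderiv ℝ w x‖ := (integral_add_compl hsm IJ2).symm
    -- set integrals against whole-space bounds
    have hθs : ∫ x in s, ‖curl w x‖ ^ 4 ≤ I4θ := by
      rw [hI4θ]; exact setIntegral_le_integral I4w (ae_of_all _ fun x => by positivity)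
    have hρc4 : ∫ x in sᶜ, ‖curl (u k - w) x‖ ^ 4 ≤ C4 :=
      (setIntegral_le_integral I4r (ae_of_all _ fun x => by positivity)).trans (h4r k)
    have hDrs : ∫ x in s, ‖fderiv ℝ (u k - w) x‖ ^ 2 ≤ CZ :=
      (setIntegral_le_integral IDr (ae_of_all _ fun x => by positivity)).trans (hDr k)
    have hDrc' : ∫ x in sᶜ, ‖fderiv ℝ (u k - w) x‖ ^ 2 ≤ CZ :=
      (setIntegral_le_integral IDr (ae_of_all _ fun x => by positivity)).trans (hDr k)
    have hDws : ∫ x in s, ‖fderiv ℝ w x‖ ^ 2 ≤ ID := by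
      rw [hID]; exact setIntegral_le_integral IDw (ae_of_all _ fun x => by positivity)
    have p1 : 0 ≤ ∫ x in s, ‖curl (u k - w) x‖ ^ 4 := integral_nonneg fun x => by positivity
    have p2 : 0 ≤ ∫ x in sᶜ, ‖curl (u k - w) x‖ ^ 4 := integral_nonneg fun x => by positivity
    have p3 : 0 ≤ ∫ x in s, ‖curl w x‖ ^ 4 := integral_nonneg fun x => by positivity
    have p4 : 0 ≤ ∫ x in sᶜ, ‖curl w x‖ ^ 4 := integral_nonneg fun x => by positivity
    have p5 : 0 ≤ ∫ x in s, ‖fderiv ℝ (u k - w) x‖ ^ 2 := integral_nonneg fun x => by positivity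
    have p6 : 0 ≤ ∫ x in sᶜ, ‖fderiv ℝ (u k - w) x‖ ^ 2 := integral_nonneg fun x => by positivity
    have p7 : 0 ≤ ∫ x in s, ‖fderiv ℝ w x‖ ^ 2 := integral_nonneg fun x => by positivity
    -- ball pieces and tail pieces
    have e1s : (∫ x in s, ‖curl (u k - w) x‖ * ‖curl w x‖ * ‖fderiv ℝ (u k - w) x‖) ≤
        Real.sqrt (Real.sqrt (∫ x in s, ‖curl (u k - w) x‖ ^ 4) * Real.sqrt I4θ) * Real.sqrt CZ := by
      refine B1s.trans ?_
      gcongr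
    have e1c : (∫ x in sᶜ, ‖curl (u k - w) x‖ * ‖curl w x‖ * ‖fderiv ℝ (u k - w) x‖) ≤
        Real.sqrt (Real.sqrt C4 * Real.sqrt (∫ x in sᶜ, ‖curl w x‖ ^ 4)) * Real.sqrt CZ := by
      refine B1c.trans ?_
      gcongr
    have e2s : (∫ x in s, ‖curl (u k - w) x‖ * ‖curl (u k - w) x‖ * ‖fderiv ℝ w x‖) ≤
        Real.sqrt (Real.sqrt (∫ x in s, ‖curl (u k - w) x‖ ^ 4) * Real.sqrt (∫ x in s, ‖curl (u k - w) x‖ ^ 4)) *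
          Real.sqrt ID := by
      refine B2s.trans ?_
      gcongr
    have e2c : (∫ x in sᶜ, ‖curl (u k - w) x‖ * ‖curl (u k - w) x‖ * ‖fderiv ℝ w x‖) ≤
        Real.sqrt (Real.sqrt C4 * Real.sqrt C4) * Real.sqrt (∫ x in sᶜ, ‖fderiv ℝ w x‖ ^ 2) := by
      refine B2c.trans ?_
      gcongr
    -- assemble
    calc |(∫ x, ⟪curl (u k - w) x, fderiv ℝ (u k - w) x (curl w x)⟫_ℝ) +
          (∫ x, ⟪curl (u k - w) x, fderiv ℝ w x (curl (u k - w) x)⟫_ℝ) +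
          (∫ x, ⟪curl w x, fderiv ℝ (u k - w) x (curl (u k - w) x)⟫_ℝ)|
        ≤ |∫ x, ⟪curl (u k - w) x, fderiv ℝ (u k - w) x (curl w x)⟫_ℝ| +
          |∫ x, ⟪curl (u k - w) x, fderiv ℝ w x (curl (u k - w) x)⟫_ℝ| +
          |∫ x, ⟪curl w x, fderiv ℝ (u k - w) x (curl (u k - w) x)⟫_ℝ| :=
          (abs_add_le _ _).trans (add_le_add (abs_add_le _ _) le_rfl)
      _ ≤ (∫ x, ‖curl (u k - w) x‖ * ‖curl w x‖ * ‖fderiv ℝ (u k - w) x‖) +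
          (∫ x, ‖curl (u k - w) x‖ * ‖curl (u k - w) x‖ * ‖fderiv ℝ w x‖) +
          (∫ x, ‖curl (u k - w) x‖ * ‖curl w x‖ * ‖fderiv ℝ (u k - w) x‖) := add_le_add (add_le_add hQ1 hQ2) hQ3
      _ ≤ _ := by
          rw [hJ1, hJ2]
          linarith [e1s, e1c, e2s, e2c]
  -- the ball part tends to `0` as `k → ∞`, for each `R`
  have hAt : ∀ R : ℕ, Tendsto (fun k =>
      2 * (Real.sqrt (Real.sqrt (∫ x in Metric.ball (0 : EuclideanSpace ℝ (Fin 3)) ((R + 1 : ℕ) : ℝ), ‖curl (u k - w) x‖ ^ 4) *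
          Real.sqrt I4θ) * Real.sqrt CZ) +
        Real.sqrt (Real.sqrt (∫ x in Metric.ball (0 : EuclideanSpace ℝ (Fin 3)) ((R + 1 : ℕ) : ℝ), ‖curl (u k - w) x‖ ^ 4) *
          Real.sqrt (∫ x in Metric.ball (0 : EuclideanSpace ℝ (Fin 3)) ((R + 1 : ℕ) : ℝ), ‖curl (u k - w) x‖ ^ 4)) * Real.sqrt ID)
      atTop (𝓝 0) := by
    intro R
    have haR : Tendsto (fun k => ∫ x in Metric.ball (0 : EuclideanSpace ℝ (Fin 3)) ((R + 1 : ℕ) : ℝ), ‖curl (u k - w) x‖ ^ 4)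
        atTop (𝓝 0) :=
      tendsto_setIntegral_curl_pow_four hu hw hP (hloc ((R + 1 : ℕ) : ℝ) (by positivity))
    have hg : Continuous (fun y : ℝ =>
        2 * (Real.sqrt (Real.sqrt y * Real.sqrt I4θ) * Real.sqrt CZ) + Real.sqrt (Real.sqrt y * Real.sqrt y) * Real.sqrt ID) := by
      fun_prop
    have h := (hg.tendsto 0).comp haR
    simp only [Real.sqrt_zero, zero_mul, mul_zero, add_zero] at h
    exact h
  -- the tail part tends to `0` as `R → ∞`
  have hTt : Tendsto (fun R : ℕ =>
      2 * (Real.sqrt (Real.sqrt C4 * Real.sqrt (∫ x in (Metric.ball (0 : EuclideanSpace ℝ (Fin 3)) ((R + 1 : ℕ) : ℝ))ᶜ,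
          ‖curl w x‖ ^ 4)) * Real.sqrt CZ) +
        Real.sqrt (Real.sqrt C4 * Real.sqrt C4) *
          Real.sqrt (∫ x in (Metric.ball (0 : EuclideanSpace ℝ (Fin 3)) ((R + 1 : ℕ) : ℝ))ᶜ, ‖fderiv ℝ w x‖ ^ 2)) atTop (𝓝 0) := by
    have ht0 : Tendsto (fun R : ℕ => ∫ x in (Metric.ball (0 : EuclideanSpace ℝ (Fin 3)) ((R + 1 : ℕ) : ℝ))ᶜ, ‖curl w x‖ ^ 4)
        atTop (𝓝 0) := (tendsto_setIntegral_compl_ball I4w).comp (tendsto_add_atTop_nat 1)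
    have hd0 : Tendsto (fun R : ℕ => ∫ x in (Metric.ball (0 : EuclideanSpace ℝ (Fin 3)) ((R + 1 : ℕ) : ℝ))ᶜ, ‖fderiv ℝ w x‖ ^ 2)
        atTop (𝓝 0) := (tendsto_setIntegral_compl_ball IDw).comp (tendsto_add_atTop_nat 1)
    have hG : Continuous (fun p : ℝ × ℝ =>
        2 * (Real.sqrt (Real.sqrt C4 * Real.sqrt p.1) * Real.sqrt CZ) + Real.sqrt (Real.sqrt C4 * Real.sqrt C4) * Real.sqrt p.2) := by
      fun_prop
    have h := (hG.tendsto (0, 0)).comp (ht0.prodMk_nhds hd0)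
    simp only [Real.sqrt_zero, mul_zero, zero_mul, add_zero] at h
    exact h
  exact tendsto_zero_of_le_add hle hAt hTt

end SeqCore

end NearSaturationNearMaximiser

end Summit.NavierStokesRegularity.NavierStokesRegularity.Theorems

end
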